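import Summits.QuantumFields.YangMills.Theses.UniversalDetector
import Summits.QuantumFields.YangMills.Theorems.UniversalDetectorDetectorExists
import Summits.QuantumFields.YangMills.Theorems.UniversalDetectorBlindRigidity

/-!
# Route `UniversalDetector`, support item `BlindDetector` (stmt-QuantumFields-24177's twin, stmt-QuantumFields-24148) —
`BlindDetector` FROM the one remaining analysis stub `BlindSeqExtraction`

Ideator seat ym-idea-8 g11 (LINE g11-1 «blind detector», lens «dual»).  The NT-side skeleton
`Cruxes/NT/Lines/blind_detector.lean` proves `blindDetector_of : BlindSeqExtraction → BlindDetectorRigidity → BlindDetector`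
(kernel-checked composition); `BlindDetectorRigidity` is LANDED (`Cruxes.BlindDetectorRigidity.blindDetectorRigidity`, seat
ym-line-sfw-p2-w4, ✓p705845).  This module moves the composition Theorems-side with the rigidity plugged in, so that the item
closes by a three-line file the moment the extraction lands (★ ym-spine-19353-p1 is proving it):

  `blindDetector_of_blindSeqExtraction (hX : <BlindSeqExtraction, verbatim>) : UniversalDetector.BlindDetector`.

Proof (as in the workfile): by contradiction with the landed universal Gaussian detector `v₀` (`universalDetector_detectorExists`):
if clause (i) fails at every `(ε, β₅, Λ₅)`, pick schemes `(β_k, L_k)` with `β_k ≥ k`, `a(β_k) L_k ≥ k` and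
`Q2_{β_k, L_k}(ϑv₀, v₀) < 1/(k+1)`; the scheme-uniform plane ceilings hold eventually along the sequence; the blind extraction
`hX` gives a subsequence and a limit kernel `K` on `Ω = {all zᵢ ≠ 0}` with `∫∫ ϑv₀ v₀ K = lim Q2 ≤ 0`, and `≥ 0` by the RP
clause, so `= 0`; blind rigidity kills `K` on `Ω`; this contradicts NONCONTACT_Ω along the subsequence.

No summit, rung or crux is proved here: `BlindDetector` still needs `BlindSeqExtraction` (XL), and `NT` stays open behind
`SchemeEdgeBit` and `SkewAtEdgeScheme`.
-/

set_option autoImplicit false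

namespace Summit.QuantumFields.YangMills.Cruxes.UniversalDetectorBlindDetector

open Summit.QuantumFields.YangMills.Theses.UniversalDetector
open MeasureTheory Literature.MathematicalPhysics.QuantumFieldTheory Literature.MathematicalPhysics.QuantumLattice
  Literature.Probability.LatticeModels Summit.QuantumFields.YangMills.Cruxes.OSLegsFromFemtoAndGap.DlrCollarTransfer

/-- **`BlindSeqExtraction → BlindDetector`** (item stmt-QuantumFields-24148 from its one remaining stub; the rigidity stub is
the landed `Cruxes.BlindDetectorRigidity.blindDetectorRigidity`). -/
theorem blindDetector_of_blindSeqExtraction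
    (hX : open MeasureTheory Literature.MathematicalPhysics.QuantumFieldTheory Literature.MathematicalPhysics.QuantumLattice Literature.Probability.LatticeModels Summit.QuantumFields.YangMills.Cruxes.OSLegsFromFemtoAndGap.DlrCollarTransfer in ∀ (G : Type) [Group G] [TopologicalSpace G] [IsTopologicalGroup G] [CompactSpace G], IsCompactSimpleLieGroup G → letI : MeasurableSpace G := borel G; haveI : BorelSpace G := ⟨rfl⟩; ∀ (r : LatticeRep G) (a : ℝ → ℝ), (∀ β, 0 < a β) → Filter.Tendsto a Filter.atTop (nhds 0) → let ker : ℝ → ℕ → (Fin 4 → ℤ) → ℝ := (fun (β : ℝ) (L : ℕ) (z : Fin 4 → ℤ) => (a β)⁻¹ ^ 8 * (torusE G r β L (fun U => dens G r 0 U * dens G r z U) - torusE G r β L (dens G r 0) * torusE G r β L (dens G r z))); let ker6 : ℝ → ℕ → Fin 4 × Fin 4 → Fin 4 × Fin 4 → (Fin 4 → ℤ) → ℝ := (fun (β : ℝ) (L : ℕ) (p q : Fin 4 × Fin 4) (z : Fin 4 → ℤ) => (a β)⁻¹ ^ 8 * (torusE G r β L (fun U => plane G r p 0 U * plane G r q z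 U) - torusE G r β L (plane G r p 0) * torusE G r β L (plane G r q z))); ∀ (βs : ℕ → ℝ) (Ls : ℕ → ℕ), Filter.Tendsto βs Filter.atTop Filter.atTop → Filter.Tendsto (fun k => a (βs k) * Ls k) Filter.atTop Filter.atTop → (∀ p q : Fin 4 × Fin 4, p.1 < p.2 → q.1 < q.2 → ∀ η : ℝ, 0 < η → ∃ C : ℝ, ∃ k₀ : ℕ, ∀ m : ℕ, k₀ ≤ m → ∀ z ∈ box 4 (Ls m), η ≤ ‖a (βs m) • siteToE z‖ → |ker6 (βs m) (Ls m) p q z| ≤ C) → (∀ p q : Fin 4 × Fin 4, p.1 < p.2 → q.1 < q.2 → ∀ η : ℝ, 0 < η → ∀ τ : ℝ, 0 < τ → ∃ Λ : ℝ, ∃ k₀ : ℕ, ∀ m : ℕ, k₀ ≤ m → ∀ (k : Fin 4) (z : Fin 4 → ℤ) (n : ℕ), (∀ j : ℕ, j ≤ n → z + Pi.single k (j : ℤ) ∈ box 4 (Ls m) ∧ η ≤ ‖a (βs m) • siteToE (z + Pi.single k (j : ℤ))‖ ∧ τ ≤ |a (βs m) * (z k + j)|) → |ker6 (βs m) (Ls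 m) p q z - ker6 (βs m) (Ls m) p q (z + Pi.single k (n : ℤ))| ≤ Λ * (a (βs m) * n)) → ∃ (φ : ℕ → ℕ) (K : EuclideanSpace ℝ (Fin 4) → ℝ), StrictMono φ ∧ (∀ η ε : ℝ, 0 < η → 0 < ε → ∃ k₀ : ℕ, ∀ k : ℕ, k₀ ≤ k → ∀ z ∈ box 4 (Ls (φ k)), (∀ i : Fin 4, η ≤ |a (βs (φ k)) * (z i : ℝ)|) → ‖a (βs (φ k)) • siteToE z‖ ≤ η⁻¹ → |ker (βs (φ k)) (Ls (φ k)) z - K (a (βs (φ k)) • siteToE z)| ≤ ε) ∧ Measurable K ∧ ContinuousOn K {z | ∀ i : Fin 4, z i ≠ 0} ∧ (∀ η : ℝ, 0 < η → ∃ C : ℝ, ∀ z : EuclideanSpace ℝ (Fin 4), η ≤ ‖z‖ → |K z| ≤ C) ∧ (∀ z : EuclideanSpace ℝ (Fin 4), K (-z) = K z) ∧ (∀ z : EuclideanSpace ℝ (Fin 4), K (timeReflection 4 z) = K z) ∧ (∀ (w : SchwartzMap (EuclideanSpace ℝ (Fin 4)) ℝ) (t₀ T : ℝ), 0 < t₀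 → tsupport (w : EuclideanSpace ℝ (Fin 4) → ℝ) ⊆ {y | t₀ ≤ y 0 ∧ y 0 ≤ T} → 0 ≤ ∫ x, ∫ y, (thetaTest 4 w) x * w y * K (y - x)) ∧ (∀ (w₁ w₂ : SchwartzMap (EuclideanSpace ℝ (Fin 4)) ℝ) (t₀ T : ℝ), 0 < t₀ → tsupport (w₁ : EuclideanSpace ℝ (Fin 4) → ℝ) ⊆ {y | t₀ ≤ -(y 0) ∧ -(y 0) ≤ T} → tsupport (w₂ : EuclideanSpace ℝ (Fin 4) → ℝ) ⊆ {y | t₀ ≤ y 0 ∧ y 0 ≤ T} → Filter.Tendsto (fun k => Q2 G r (βs (φ k)) (Ls (φ k)) (a (βs (φ k))) w₁ w₂) Filter.atTop (nhds (∫ x, ∫ y, w₁ x * w₂ y * K (y - x))))) :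
    Summit.QuantumFields.YangMills.Theses.UniversalDetector.BlindDetector := by
  intro G _ _ _ _ hG r a ha hlim ker ker6 hBdd hLong hN
  obtain ⟨v₀, h, ta, tb, hta, hhc, hh0, hhsupp, hhne, hv₀, hsuppv, hsuppθ⟩ :=
    Summit.QuantumFields.YangMills.Theorems.universalDetector_detectorExists
  by_contra hcon
  push Not at hcon
  have hsupp0 : tsupport (v₀ : EuclideanSpace ℝ (Fin 4) → ℝ) ⊆ {y | 0 < y 0} := fun y hy =>
    lt_of_lt_of_le hta (hsuppv hy).1
  choose βs hβs Ls hLs hQs using fun k : ℕ => hcon v₀ (1 / ((k : ℝ) + 1)) k k hsupp0 (by positivity)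
  have hβs' : Filter.Tendsto βs Filter.atTop Filter.atTop :=
    Filter.tendsto_atTop_mono hβs tendsto_natCast_atTop_atTop
  have haL' : Filter.Tendsto (fun k => a (βs k) * (Ls k : ℝ)) Filter.atTop Filter.atTop :=
    Filter.tendsto_atTop_mono hLs tendsto_natCast_atTop_atTop
  -- the scheme-uniform ceilings hold eventually along the sequence (βs, Ls)
  have hev : ∀ β₅ Λ₅ : ℝ, ∃ k₀ : ℕ, ∀ m : ℕ, k₀ ≤ m → β₅ ≤ βs m ∧ Λ₅ ≤ a (βs m) * (Ls m : ℝ) := by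
    intro β₅ Λ₅
    obtain ⟨k₁, hk₁⟩ := Filter.eventually_atTop.1 (hβs'.eventually_ge_atTop β₅)
    obtain ⟨k₂, hk₂⟩ := Filter.eventually_atTop.1 (haL'.eventually_ge_atTop Λ₅)
    exact ⟨max k₁ k₂, fun m hm => ⟨hk₁ m (le_of_max_le_left hm), hk₂ m (le_of_max_le_right hm)⟩⟩
  have hBdd' : ∀ p q : Fin 4 × Fin 4, p.1 < p.2 → q.1 < q.2 → ∀ η : ℝ, 0 < η → ∃ C : ℝ, ∃ k₀ : ℕ, ∀ m : ℕ, k₀ ≤ m → ∀ z ∈ box 4 (Ls m), η ≤ ‖a (βs m) • siteToE z‖ → |ker6 (βs m) (Ls m) p q z| ≤ C := by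
    intro p q hp hq η hη
    obtain ⟨C, β₅, Λ₅, hC⟩ := hBdd p q hp hq η hη
    obtain ⟨k₀, hk₀⟩ := hev β₅ Λ₅
    exact ⟨C, k₀, fun m hm z hz hηz => hC (βs m) (hk₀ m hm).1 (Ls m) (hk₀ m hm).2 z hz hηz⟩
  have hLong' : ∀ p q : Fin 4 × Fin 4, p.1 < p.2 → q.1 < q.2 → ∀ η : ℝ, 0 < η → ∀ τ : ℝ, 0 < τ → ∃ Λ : ℝ, ∃ k₀ : ℕ, ∀ m : ℕ, k₀ ≤ m → ∀ (k : Fin 4) (z : Fin 4 → ℤ) (n : ℕ), (∀ j : ℕ, j ≤ n → z + Pi.single k (j : ℤ) ∈ box 4 (Ls m) ∧ η ≤ ‖a (βs m) • siteToE (z + Pi.single k (j : ℤ))‖ ∧ τ ≤ |a (βs m) * (z k + j)|) → |ker6 (βs m) (Ls m) p q z - ker6 (βs m) (Ls m) p q (z + Pi.single k (n : ℤ))| ≤ Λ * (a (βs m) * n) := by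
    intro p q hp hq η hη τ hτ
    obtain ⟨Λ, β₅, Λ₅, hΛ⟩ := hLong p q hp hq η hη τ hτ
    obtain ⟨k₀, hk₀⟩ := hev β₅ Λ₅
    exact ⟨Λ, k₀, fun m hm k z n hzn => hΛ (βs m) (hk₀ m hm).1 (Ls m) (hk₀ m hm).2 k z n hzn⟩
  -- blind extraction: a subsequential limit kernel K, controlled on Ω = {all coordinates ≠ 0} only
  obtain ⟨φ, K, hφ, hconv, hKm, hKc, hKb, hKe, hKθ, hRP, hQ2lim⟩ :=
    hX G hG r a ha hlim βs Ls hβs' haL' hBdd' hLong'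
  have hlimQ := hQ2lim _ v₀ ta tb hta hsuppθ hsuppv
  have hg0 : Filter.Tendsto (fun k => 1 / ((φ k : ℝ) + 1)) Filter.atTop (nhds 0) :=
    tendsto_one_div_add_atTop_nhds_zero_nat.comp hφ.tendsto_atTop
  have hIle := le_of_tendsto_of_tendsto hlimQ hg0 (Filter.Eventually.of_forall fun k => (hQs (φ k)).le)
  have hI0 := le_antisymm hIle (hRP v₀ ta tb hta hsuppv)
  -- blind rigidity: the universal detector kills K on Ω
  have hK0 : ∀ z : EuclideanSpace ℝ (Fin 4), (∀ i : Fin 4, z i ≠ 0) → K z = 0 :=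
    Summit.QuantumFields.YangMills.Cruxes.BlindDetectorRigidity.blindDetectorRigidity K h ta tb v₀ hKm hKc hKb hKe hKθ hRP hta
      hhc hh0 hhsupp hhne hv₀ hI0
  -- NONCONTACT_Ω along the extracted subsequence: contradiction
  obtain ⟨z, hz, hKz⟩ := hN (fun k => βs (φ k)) (fun k => Ls (φ k)) K (hβs'.comp hφ.tendsto_atTop)
    (haL'.comp hφ.tendsto_atTop) hconv
  exact hKz (hK0 z hz)

end Summit.QuantumFields.YangMills.Cruxes.UniversalDetectorBlindDetector
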